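import Summits.HodgeConjecture.HodgeConjecture.Theses.HolomorphicityRate

/-!
# Route HolomorphicityRate · item `NonHodgeRateAtMostOne` (stmt-HodgeConjecture-2738): the true range

`NonHodgeRateAtMostOne` (R3 of the card *holomorphicity-rate-threshold*) says: along a ray
`m•c + a_k•hp` (`a_k ≤ C·k^p`) through a rational class `c` NOT of type `(p,p)`, nearly holomorphic
cycle supports of defect `≤ t_k` with `t_k·k → 0` occur only finitely often.  The threshold lemma
`ThresholdForcesHodgeType` (E2, stmt-HodgeConjecture-10764) has the SAME shape with the hypothesis
`t_k·k^p → 0`.  This file records, kernel-checked, the part of R3 that E2 carries: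

* `nonHodgeRate_of_thresholdForcesHodgeType` : E2 ⟹ R3 with the threshold `t_k·k^p → 0` in place of
  `t_k·k → 0` (the contrapositive of E2 for rational `c`, `IsOfHodgeType` being `∃` over Hodge
  models).  This is the REPAIRED statement `C′` proposed in the seat's release note: it is what the
  informal gloss "transcendental classes cannot beat the threshold" means on the Kodaira ray, where
  the budget `a_k ≤ C·k^p` lets the degree grow like `k^p`.
* `nonHodgeRateAtMostOne_of_le_one_of_thresholdForcesHodgeType` : E2 ⟹ R3 AS FILED for `p ≤ 1`
  (`t_k·k → 0` gives `t_k·k^p → 0` when `p ≤ 1`).  For `p = 1` this is the case the item's docstring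
  calls "a theorem to be formalised" (Lefschetz `(1,1)` range); for `p = 0` the non-Hodge hypothesis is
  even void (`isOfHodgeType_zero_zero_zero`).

For `p ≥ 2` the filed hypothesis `t_k·k → 0` is strictly weaker than E2's, and for `3 ≤ p ≤ n - 1`
on any `X` with `h^{2,0}(X) ≠ 0` the filed statement contradicts the printed Donaldson–Auroux
estimates (reindex `j = k^p` the rate-`1/2` representatives of `(m•α + j•h)•h^{p-1}` cut out inside a
fixed complete intersection `h^{p-1}`): see the negative lemma
`Theorems/NonHodgeRateAtMostOne/Negative/NonHodgeRateAtMostOneFalseOfNonHodgeRayAtRate.lean` and the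
evidence file attached to the item.  Nothing here asserts a Theses decl unconditionally.
Prover seat prover-pitem-stmt-HodgeConjecture-2738-0, 2026-08-16.
-/

namespace Summit.HodgeConjecture.HodgeConjecture.Theorems

open scoped Manifold Topology
open Summit.HodgeConjecture.HodgeConjecture.Theses.HolomorphicityRate
open Filter

/-- **E2 ⟹ repaired R3.** With the threshold exponent `p` (`t_k·k^p → 0`) instead of `1`, the
sharpness statement for rational non-`(p,p)` classes is the contrapositive of
`ThresholdForcesHodgeType`: a super-threshold ray through `c` would put `A.pullback c` in `H^{p,p}`
of the very Hodge model `A` of the hypothesis, so `c` would be of Hodge type `(p,p)`.  This is the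
statement `C′` the seat proposes as the repair of stmt-HodgeConjecture-2738 (identical text, one
exponent changed). -/
theorem nonHodgeRate_of_thresholdForcesHodgeType (hE2 : ThresholdForcesHodgeType) :
    ∀ (n p : ℕ) (X : Literature.AlgebraicGeometry.Motives.SchemeOver ℂ),
      Literature.AlgebraicGeometry.Motives.IsSmoothProjective n X → p ≤ n → ∀ (A :
      Literature.AlgebraicGeometry.HodgeTheory.HodgeModel n X) (g :
      Bundle.ContMDiffRiemannianMetric 𝓘(ℝ, A.model) ((⊤ : ℕ∞) : WithTop ℕ∞) A.model (fun x :
      A.carrier => TangentSpace 𝓘(ℝ, A.model) x)) (c hp :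
      Literature.AlgebraicGeometry.HodgeTheory.complexBetti X (2 * p)) (m : ℕ) (C : ℝ) (a : ℕ → ℕ)
      (t : ℕ → ℝ), Literature.AlgebraicGeometry.HodgeTheory.IsRationalClass c → ¬
      Literature.AlgebraicGeometry.HodgeTheory.IsOfHodgeType n X (2 * p) p p c →
      Literature.AlgebraicGeometry.HodgeTheory.IsRationalClass hp → hp ∈
      Literature.AlgebraicGeometry.HodgeTheory.algebraicClasses X p → 0 < m → (∀ k, (a k : ℝ) ≤ C *
      (k : ℝ) ^ p) → Filter.Tendsto (fun k : ℕ => t k * (k : ℝ) ^ p) Filter.atTop (nhds 0) → ¬ (∃ᶠ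
      k : ℕ in Filter.atTop, ∃ S Sg : Set A.carrier, (IsClosed S ∧ IsClosed Sg ∧ Sg ⊆ S ∧
      IsConnected (S \ Sg) ∧ (∀ x ∈ Sg, Literature.Geometry.Kaehler.IsAnalyticSetAt 𝓘(ℂ, A.model) S
      x) ∧ (∃ T : Set A.carrier, Sg ⊆ T ∧ (Literature.Geometry.Kaehler.IsAnalyticSet 𝓘(ℂ, A.model)
      T ∧ ∀ x ∈ Literature.Geometry.Kaehler.regularLocus 𝓘(ℂ, A.model) T, ∀ q : ℕ,
      Literature.Geometry.Kaehler.IsRegularPointOfCodim 𝓘(ℂ, A.model) T q x → p + 1 ≤ q)) ∧ (∀ x ∈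
      S \ Sg, ∃ U : Set A.carrier, IsOpen U ∧ x ∈ U ∧ ∃ f : A.carrier → (Fin (2 * p) → ℝ),
      ContMDiffOn 𝓘(ℝ, A.model) 𝓘(ℝ, Fin (2 * p) → ℝ) 1 f U ∧ S ∩ U = U ∩ f ⁻¹' {0} ∧
      Function.Surjective (mfderiv 𝓘(ℝ, A.model) 𝓘(ℝ, Fin (2 * p) → ℝ) f x) ∧ ∀ v : TangentSpace
      𝓘(ℝ, A.model) x, mfderiv 𝓘(ℝ, A.model) 𝓘(ℝ, Fin (2 * p) → ℝ) f x v = 0 → ∃ w : TangentSpace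
      𝓘(ℝ, A.model) x, mfderiv 𝓘(ℝ, A.model) 𝓘(ℝ, Fin (2 * p) → ℝ) f x w = 0 ∧ g.inner x
      (Literature.Geometry.Kaehler.tangentJ A.model x v - w) (Literature.Geometry.Kaehler.tangentJ
      A.model x v - w) ≤ (t k) ^ 2 * g.inner x v v)) ∧
      Literature.AlgebraicTopology.SingularHomology.singularCohomology.map ℂ ℂ (⟨Subtype.val,
      continuous_subtype_val⟩ : C({x : A.carrier // x ∉ S}, A.carrier)) (2 * p) (A.pullback (2 * p)
      (((m : ℂ) • c + ((a k : ℕ) : ℂ) • hp))) = 0) := by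
  intro n p X hX hpn A g c hp m C a t _hc hnH hrat halg hm hbud ht hfreq
  exact hnH ⟨A, hE2 n p X hX hpn A g c hp m C a t hrat halg hm hbud ht hfreq⟩

/-- **E2 ⟹ R3 as filed, for `p ≤ 1`.** In complex codimension `≤ 1` the filed threshold
`t_k·k → 0` implies E2's `t_k·k^p → 0`, so the item holds there modulo `ThresholdForcesHodgeType`
(for `p = 1` this is the Lefschetz-`(1,1)`-range case the item's docstring singles out; for `p = 0`
there are no non-`(0,0)` classes at all).  The statement is the item's text with the extra
hypothesis `p ≤ 1`. -/
theorem nonHodgeRateAtMostOne_of_le_one_of_thresholdForcesHodgeType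
    (hE2 : ThresholdForcesHodgeType) :
    ∀ (n p : ℕ) (X : Literature.AlgebraicGeometry.Motives.SchemeOver ℂ),
      Literature.AlgebraicGeometry.Motives.IsSmoothProjective n X → p ≤ n → p ≤ 1 → ∀ (A :
      Literature.AlgebraicGeometry.HodgeTheory.HodgeModel n X) (g :
      Bundle.ContMDiffRiemannianMetric 𝓘(ℝ, A.model) ((⊤ : ℕ∞) : WithTop ℕ∞) A.model (fun x :
      A.carrier => TangentSpace 𝓘(ℝ, A.model) x)) (c hp :
      Literature.AlgebraicGeometry.HodgeTheory.complexBetti X (2 * p)) (m : ℕ) (C : ℝ) (a : ℕ → ℕ)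
      (t : ℕ → ℝ), Literature.AlgebraicGeometry.HodgeTheory.IsRationalClass c → ¬
      Literature.AlgebraicGeometry.HodgeTheory.IsOfHodgeType n X (2 * p) p p c →
      Literature.AlgebraicGeometry.HodgeTheory.IsRationalClass hp → hp ∈
      Literature.AlgebraicGeometry.HodgeTheory.algebraicClasses X p → 0 < m → (∀ k, (a k : ℝ) ≤ C *
      (k : ℝ) ^ p) → Filter.Tendsto (fun k : ℕ => t k * (k : ℝ)) Filter.atTop (nhds 0) → ¬ (∃ᶠ k :
      ℕ in Filter.atTop, ∃ S Sg : Set A.carrier, (IsClosed S ∧ IsClosed Sg ∧ Sg ⊆ S ∧ IsConnected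
      (S \ Sg) ∧ (∀ x ∈ Sg, Literature.Geometry.Kaehler.IsAnalyticSetAt 𝓘(ℂ, A.model) S x) ∧ (∃ T :
      Set A.carrier, Sg ⊆ T ∧ (Literature.Geometry.Kaehler.IsAnalyticSet 𝓘(ℂ, A.model) T ∧ ∀ x ∈
      Literature.Geometry.Kaehler.regularLocus 𝓘(ℂ, A.model) T, ∀ q : ℕ,
      Literature.Geometry.Kaehler.IsRegularPointOfCodim 𝓘(ℂ, A.model) T q x → p + 1 ≤ q)) ∧ (∀ x ∈
      S \ Sg, ∃ U : Set A.carrier, IsOpen U ∧ x ∈ U ∧ ∃ f : A.carrier → (Fin (2 * p) → ℝ),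
      ContMDiffOn 𝓘(ℝ, A.model) 𝓘(ℝ, Fin (2 * p) → ℝ) 1 f U ∧ S ∩ U = U ∩ f ⁻¹' {0} ∧
      Function.Surjective (mfderiv 𝓘(ℝ, A.model) 𝓘(ℝ, Fin (2 * p) → ℝ) f x) ∧ ∀ v : TangentSpace
      𝓘(ℝ, A.model) x, mfderiv 𝓘(ℝ, A.model) 𝓘(ℝ, Fin (2 * p) → ℝ) f x v = 0 → ∃ w : TangentSpace
      𝓘(ℝ, A.model) x, mfderiv 𝓘(ℝ, A.model) 𝓘(ℝ, Fin (2 * p) → ℝ) f x w = 0 ∧ g.inner x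
      (Literature.Geometry.Kaehler.tangentJ A.model x v - w) (Literature.Geometry.Kaehler.tangentJ
      A.model x v - w) ≤ (t k) ^ 2 * g.inner x v v)) ∧
      Literature.AlgebraicTopology.SingularHomology.singularCohomology.map ℂ ℂ (⟨Subtype.val,
      continuous_subtype_val⟩ : C({x : A.carrier // x ∉ S}, A.carrier)) (2 * p) (A.pullback (2 * p)
      (((m : ℂ) • c + ((a k : ℕ) : ℂ) • hp))) = 0) := by
  intro n p X hX hpn hp1 A g c hp m C a t _hc hnH hrat halg hm hbud ht hfreq
  refine hnH ⟨A, hE2 n p X hX hpn A g c hp m C a t hrat halg hm hbud ?_ hfreq⟩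
  rcases Nat.le_one_iff_eq_zero_or_eq_one.mp hp1 with rfl | rfl
  · have h1 : Tendsto (fun k : ℕ => (k : ℝ)⁻¹) atTop (nhds 0) :=
      tendsto_inv_atTop_zero.comp tendsto_natCast_atTop_atTop
    have h2 : Tendsto (fun k : ℕ => t k * (k : ℝ) * (k : ℝ)⁻¹) atTop (nhds 0) := by
      simpa only [zero_mul] using ht.mul h1
    refine h2.congr' ?_
    filter_upwards [eventually_gt_atTop 0] with k hk
    have hk' : (k : ℝ) ≠ 0 := Nat.cast_ne_zero.mpr hk.ne'
    rw [pow_zero, mul_one, mul_assoc, mul_inv_cancel₀ hk', mul_one]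
  · simpa only [pow_one] using ht

end Summit.HodgeConjecture.HodgeConjecture.Theorems
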